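import Summits.HodgeConjecture.Statement
import Summits.HodgeConjecture.HodgeConjecture.Theorems.HeckePrymWeilHyperbolicEightfoldsSqrtMinus7OfAnchorObject
import Summits.HodgeConjecture.HodgeConjecture.Theorems.WeilTypeLadderVariationalLocal
import Summits.HodgeConjecture.HodgeConjecture.Theorems.WeilTypeLadder
import Summits.HodgeConjecture.HodgeConjecture.Theorems.WeilTypeLadderQuadraticVariationalEngineTwisted
import Literature.AlgebraicGeometry.HodgeTheory.WeilClassesLocalAnchor
import Literature.AlgebraicGeometry.HodgeTheory.WeilClassesSixfolds
import Literature.AlgebraicGeometry.HodgeTheory.MotivatedClassesDeformationInputs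
import HarnessLib

/-!
# WeilTypeLadder · LOCAL ANCHOR ⟹ every hyperbolic member: the floor F0a re-derived inside the anchor ∧ transport skeleton

b2b cell `hweil` (packet `run/shared/lean/b2b/hodge-weil/`, `LADDER.md ## CARVER — v3` row pv2-g3; notes
`b2b-hweil-pv2-g3/VARIATIONAL-G3.md`). Prover 2, generation 3 (variational). The floor F0a of the ladder is the
named fact `Markman2025_weilClasses_algebraic_hyperbolicSixfold` (`Literature/…/WeilClassesSixfolds.lean`): Markman,
arXiv:2502.03415 Thm. 1.5.1 (UNREFEREED) — Weil classes algebraic on every hyperbolic (`det H = -1`) abelian sixfold of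
`ℚ(√-d)`-Weil type, every `d`. Markman's proof has a LOCAL half (a semiregular twisted reflexive sheaf at the secant
anchor `X × X̂` whose `κ`-class deforms along the 9-dimensional Weil locus: Thm. 1.4.1, Lemma 9.3.11, Conj. 7.3.9 proved
for abelian families in §7.4.2 [arXiv v2 numbering; held corpus rendering "§7.5.2"]) and a GLOBAL half (proof of
Thm. 1.5.1, last paragraph: "The locus in moduli where the
Hodge-Weil classes are algebraic is a countable union of closed algebraic susbsets [voisin]. Hence, the locus contains
the whole irreducible component of moduli of deformations of `(X × X̂, η, h)`", plus "`(n, K, det H)` determines the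
component" and isogeny invariance). This file KERNEL-CHECKS the global half on the tree's real carriers and thereby
isolates the floor's dependence on the preprint to ONE local sentence per `d`, the named claim-fact
`Markman2025_secantAnchor_locallyAlgebraic_sixfold : ∀ d ≥ 1, HasLocallyAlgebraicWeilAnchor 3 d`
(`Literature/…/WeilClassesLocalAnchor.lean`, this seat):

* `weilClasses_algebraic_hyperbolic_of_localAnchor` — for EVERY `n, d ≥ 1`:
  `HasLocallyAlgebraicWeilAnchor n d` ∧ `weilFamilyReach_hyperbolic` (Deligne's polarized Weil family with reach;
  refereed inputs Deligne 1982 / van Geemen / Landherr / Mumford–Fogarty–Kirwan / Milne) ⟹ the Weil plane of EVERY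
  hyperbolic `(A, φ, h(e_A, a_A))` of dimension `2n`, `φ ≫ φ = -d`, is algebraic. MECHANISM (all kernel-checked): the
  reach fact carries the anchor's `h_K` as a global `H` and the anchor class `w` as a flat `(n,n)` section `σ`,
  globalised to `W ∈ H^{2n}(𝒳)` (W-engine `stub_globalClassEngine`, Deligne 1968 discharged) and rational along `σ`
  (`stub_rationalAlongSection`); the LOCAL ANCHOR gives an open `U ∋ s₀` and `q ∈ ℚ` with `(q·Hⁿ + W)|_{𝒳_s}`
  algebraic for `s ∈ U`; the Baire lemma `mem_algebraicClasses_of_isOpen_subset_algebraicityLocus`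
  (Charles–Schnell countable union THEOREM + Baire + Mumford's curve lemma, `Theorems/WeilTypeLadderVariationalLocal`)
  spreads this to EVERY `s` — in particular to the fibre `𝒳_{s₁} ≅ A'` `K`-isogenous to the target; `H_{s₁}ⁿ` is
  algebraic (Lefschetz `(1,1)` on `A'`, discharged, + Kleiman); so `W_{s₁}` is a non-zero algebraic class of the
  Weil plane of `A'`; ONE CLASS SUFFICES (`weilClassesOf_le_algebraicClasses_iff_exists_ne_zero_of_dim_eq`,
  unconditional); isogeny transfer (`stub_isogenyTransfer`). This is `weilClasses_algebraic_of_anchorObject`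
  (crux 14642, lead c11) with the pair (Perry's theorem, semiregular anchor OBJECT) replaced by the weaker CLASS-level
  local statement — the only form in which Markman's twisted reflexive anchor is typable today.
* `markman2025_hyperbolicSixfold_of_reach_of_secantAnchor` — **F0a BY NAME**:
  `weilFamilyReach_hyperbolic → Markman2025_secantAnchor_locallyAlgebraic_sixfold →
  Markman2025_weilClasses_algebraic_hyperbolicSixfold`. The floor's trust base thus splits as
  {refereed reach inputs} ∪ {ONE local sentence of the preprint per `d`} ∪ {kernel}.
* `splitEightfolds_of_reach_of_localAnchor`, `splitWeilAbelianVarieties_of_reach_of_localAnchor` — the same glue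
  one and all dimensions up: R2₈ (`SplitEightfolds`) ⟸ reach ∧ `∀ d, HasLocallyAlgebraicWeilAnchor 4 d`; R2
  (`SplitWeilAbelianVarieties`) ⟸ reach ∧ `∀ n ≥ 4, ∀ d, HasLocallyAlgebraicWeilAnchor n d`. So above the floor
  the open content of every SPLIT rung is exactly a locally algebraic anchor (no such anchor is known for `n ≥ 4`:
  Markman §1.2, and the cell's census `b2b-hweil-pv1*`).
* `hasLocallyAlgebraicWeilAnchor_of_perryTwisted_kappaAnchorObject` — the OBJECT-level cut FEEDS the class-level
  one: Perry's Thm. 1.1 (2) with a `B`-field (`Perry2026_semiregularTwisted_remainsAlgebraic`, claim-fact) ∧ ONE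
  hyperbolic anchor carrying, on every chart, a finite locally free FULLY SEMIREGULAR `E₀` with a rational `(1,1)`
  `B`-field whose twisted Chern character is `Σ q_k h_Kᵏ + w` (`w` in degree `2n`) ⟹ `HasLocallyAlgebraicWeilAnchor n d`
  (with `U = S(ℂ)`: Perry's conclusion is global), via the landed twisted engine `engine_of_perry_twisted`
  (`Theorems/WeilTypeLadderQuadraticVariationalEngineTwisted`, gen 2). So the two cuts of the floor meet in the
  predicate: Markman's twisted reflexive `𝓑` supplies it by the claim-fact, a locally free `κ`-anchor would supply it
  by Perry.
* `hasLocallyAlgebraicWeilAnchor_of_hodgeConjecture` — on-path sanity: under `HodgeConjecture` the local clause is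
  automatic, so the predicate reduces to the existence of a hyperbolic anchor with a non-zero rational Weil class
  (supplied as a hypothesis; the tree constructs such anchors elsewhere, e.g. `WeilClassesDescendingHolds`).

Sibling `Theorems/WeilTypeLadderDegenerationUp.lean` (this seat): R2₈ ⟹ R1 ⟹ R1′ and R∞ ⟺ F0a ∧ R2 by degeneration to
products with Weil surfaces one dimension up, hence ALL sixfolds from one dimension-8 local anchor per `d`.

Nothing is asserted: every Markman / Deligne input is a hypothesis BY NAME. Sorry-free; no definition; no new
notion (the predicate lives in Literature). Serves stmt-HodgeConjecture-2524 (R1 `WeilSixfolds`) without closing it.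
-/

-- every declaration of this problem lives in `Summit.HodgeConjecture.HodgeConjecture.…` (summit = sub-problem)
set_option linter.dupNamespace false

noncomputable section

open CategoryTheory AlgebraicGeometry Limits MonoidalCategory CartesianMonoidalCategory

namespace Summit.HodgeConjecture.HodgeConjecture.WeilTypeLadder

open Literature.AlgebraicGeometry Literature.AlgebraicGeometry.Motives
open Literature.AlgebraicGeometry.HodgeTheory
open Literature.AlgebraicTopology.SingularHomology
open Summit.HodgeConjecture.HodgeConjecture.Theorems.HeckePrymWeilLine
  (stub_rationalAlongSection stub_isogenyTransfer owf_isoTransport)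
open Summit.HodgeConjecture.HodgeConjecture.Theorems.HyperbolicEightfoldsSqrtMinus7.TensorAnchor
  (stub_globalClassEngine)
open Summit.HodgeConjecture.HodgeConjecture.Theorems.HyperbolicEightfoldsSqrtMinus7.AnchorObject
  (complexBetti_map_cupPowTwo cupPowTwo_mem_algebraicClasses_abelian)

/-! ## LOCAL ANCHOR ∧ reach ⟹ the Weil plane of every hyperbolic member (all `n, d ≥ 1`) -/

/-- **Weil classes on EVERY hyperbolic `√-d`-Weil abelian `2n`-fold are algebraic, given ONE locally algebraic
hyperbolic anchor and Deligne's hyperbolic family with reach** (every `n, d ≥ 1`; hypotheses `hL`, `hF` BY NAME,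
nothing asserted). Deligne's family through the anchor `P` (`hF`) carries `h_K` as `H` and `w` as the flat section
`σ = W|_{𝒳_s}` (W-engine, rational along `σ`), and reaches the target `A` through a fibre `A' ≅ 𝒳_{s₁}` by a
`K`-isogeny; the local anchor gives `(q·Hⁿ + W)|_{𝒳_s}` algebraic on an open `U ∋ s₀`; the Baire lemma
(Charles–Schnell countable union of closed algebraic subsets, Mumford's curve lemma — Markman's "[voisin]" step)
makes it algebraic on EVERY fibre; `H_{s₁}ⁿ` is algebraic (Lefschetz `(1,1)` + Kleiman on `A'`); one non-zero
algebraic Weil class suffices on `A'`; isogeny transfer. [cite: Markman2025SecantWeil, proof of Thm. 1.5.1 (§9.3)]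
[cite: Deligne1982HodgeCycles, proof of Thm. 4.8] [cite: CharlesSchnell2014Notes, Prop. 11.3.11 (proof)]
[cite: vanGeemen1994HodgeAV, proof of Thm. 6.12] -/
theorem weilClasses_algebraic_hyperbolic_of_localAnchor (n d : ℕ) (hn : 1 ≤ n) (hd : 1 ≤ d)
    (hL : HasLocallyAlgebraicWeilAnchor n d) (hF : weilFamilyReach_hyperbolic)
    (A : AbelianVariety ℂ) (φ : A ⟶ A) (hA : A.dim = 2 * n) (hφ : φ ≫ φ = -(d • 𝟙 A))
    (eA : ProjectiveEmbedding A.X) (aA : complexBetti (projectiveSpace eA.n ℂ) 2) (haA : IsRationalClass aA)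
    (haA0 : aA ≠ 0)
    (hhypA : IsHyperbolicWeilType A φ n
      ((d : ℂ) • complexBetti.map eA.ι 2 aA + complexBetti.map φ.hom.hom.hom 2 (complexBetti.map eA.ι 2 aA))) :
    weilClassesOf A φ n d ≤ algebraicClasses A.X n := by
  -- `n = m + 1`
  obtain ⟨m, rfl⟩ : ∃ m, n = m + 1 := ⟨n - 1, by omega⟩
  -- the locally algebraic anchor
  obtain ⟨P, ψ, e, a, w, hP8, hψ, ha, ha0, hhyp, hwW, hwrat, hw0, hloc⟩ := hL
  set h : complexBetti P.X 2 :=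
    (d : ℂ) • complexBetti.map e.ι 2 a + complexBetti.map ψ.hom.hom.hom 2 (complexBetti.map e.ι 2 a) with hhdef
  -- Deligne's family through the hyperbolic anchor `P`, section through `w`, reaching `A`
  obtain ⟨𝒳, S, f, s₀, s₁, e', A', φ', e₁, σ, H, hfam, hemb, hirr, hsm, hSqp, hchart, hHfib, hHs₀, hσc, hpt, hσH,
      hσ₀, hA'dim, hφ'A, ⟨u, v, m', hm', huv, hu, hv⟩, w₁, hσ₁, hw₁W, hw₁0⟩ :=
    hF (m + 1) d hn hd P ψ e a hP8 hψ ha ha0 hhyp w hwW hw0 A φ eA aA hA hφ haA haA0 hhypA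
  haveI := hirr
  -- the total space is quasi-projective (closed in `ℙᴺ × S`)
  have h𝒳qp : IsQuasiProjectiveOver 𝒳 := by
    obtain ⟨N, ι, hι, -⟩ := hemb
    haveI := hι
    exact IsQuasiProjectiveOver.of_isClosedImmersion_projectiveSpace_tensor ι hSqp
  -- the W-engine: `σ` is the restriction of a global class `W`
  obtain ⟨W, hWσ⟩ := stub_globalClassEngine f (2 * (m + 1)) (2 * (m + 1)) hfam hemb hsm hSqp hirr σ hσc hpt
  have hcls : ∀ (s : ComplexPoints S) (y : complexBetti (fiberOver f s) (2 * (m + 1))),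
      σ s = ⟨s, y⟩ → complexBetti.map (fiberι f s) (2 * (m + 1)) W = y := by
    intro s y hy
    have h := (hWσ s).symm.trans hy
    simp only [globalSection, FiberClass.mk.injEq, heq_eq_eq, true_and] at h
    exact h
  have hW₀ : complexBetti.map (fiberι f s₀) (2 * (m + 1)) W = complexBetti.map e'.inv (2 * (m + 1)) w :=
    hcls s₀ _ hσ₀
  have hW₁ : complexBetti.map (fiberι f s₁) (2 * (m + 1)) W = w₁ := hcls s₁ _ hσ₁
  -- rationality along the section (landed), Hodge type along the section (the fact)
  have hrat₀ : IsRationalClass (σ s₀).cls := by rw [hσ₀]; exact hwrat.map _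
  have hratσ : ∀ s, IsRationalClass (σ s).cls :=
    stub_rationalAlongSection f (2 * (m + 1)) (2 * (m + 1)) hfam hsm hSqp hirr σ hσc hpt s₀ hrat₀
  have hWfib : ∀ s, IsRationalClass (complexBetti.map (fiberι f s) (2 * (m + 1)) W) ∧
      IsOfHodgeType (2 * (m + 1)) (fiberOver f s) (2 * (m + 1)) (m + 1) (m + 1)
        (complexBetti.map (fiberι f s) (2 * (m + 1)) W) := by
    intro s
    have h1 := hratσ s
    have h2 := hσH s
    rw [hWσ s] at h1 h2
    exact ⟨h1, h2⟩
  -- the anchor conditions at `s₀`: `e'^*(H|_{s₀}) = h_K`, `e'^*(W|_{s₀}) = w`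
  rw [← hhdef] at hHs₀
  have hWs₀ : complexBetti.map e'.hom (2 * (m + 1)) (complexBetti.map (fiberι f s₀) (2 * (m + 1)) W) = w := by
    rw [hW₀, e'.complexBetti_map_hom_map_inv]
  -- THE LOCAL ANCHOR: an open `U ∋ s₀` of algebraic fibres for `q • Hⁿ + W`
  obtain ⟨U, q, hUo, hs₀U, hUalg⟩ :=
    hloc f hfam h𝒳qp hSqp hirr hsm hchart H W hHfib hWfib s₀ e' hHs₀ hWs₀
  -- the global class `q • Hⁿ + W` and its fibre restrictions
  set B : complexBetti 𝒳 (2 * (m + 1)) := ((q : ℚ) : ℂ) • cupPowTwo H (m + 1) + W with hBdef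
  have hBres : ∀ s, complexBetti.map (fiberι f s) (2 * (m + 1)) B =
      ((q : ℚ) : ℂ) • cupPowTwo (complexBetti.map (fiberι f s) 2 H) (m + 1) +
        complexBetti.map (fiberι f s) (2 * (m + 1)) W := by
    intro s
    rw [hBdef, map_add, map_smul, complexBetti_map_cupPowTwo]
  have hUalgB : ∀ t ∈ U, complexBetti.map (fiberι f t) (2 * (m + 1)) B ∈ algebraicClasses (fiberOver f t) (m + 1) :=
    fun t ht => by rw [hBres t]; exact hUalg t ht
  -- GLOBAL from LOCAL: Baire + countable union of closed algebraic subsets (Markman's "[voisin]" step)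
  have hBall : ∀ t : ComplexPoints S,
      complexBetti.map (fiberι f t) (2 * (m + 1)) B ∈ algebraicClasses (fiberOver f t) (m + 1) :=
    mem_algebraicClasses_of_isOpen_subset_algebraicityLocus f h𝒳qp hSqp hsm hfam B hUo ⟨s₀, hs₀U⟩ hUalgB
  have halg : ((q : ℚ) : ℂ) • cupPowTwo (complexBetti.map (fiberι f s₁) 2 H) (m + 1) +
      complexBetti.map (fiberι f s₁) (2 * (m + 1)) W ∈ algebraicClasses (fiberOver f s₁) (m + 1) := by
    rw [← hBres s₁]; exact hBall s₁
  -- `H_{s₁}ⁿ` is algebraic on `𝒳_{s₁}`: Lefschetz (1,1) + Kleiman on the abelian `A' ≅ 𝒳_{s₁}`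
  have hA'sp : IsSmoothProjective (2 * (m + 1)) A'.X := by
    have h := AbelianVariety.isSmoothProjective_holds (A := A')
    rw [AbelianVariety.isSmoothProjective, hA'dim] at h
    exact h
  have hh₁alg : complexBetti.map e₁.hom 2 (complexBetti.map (fiberι f s₁) 2 H) ∈ algebraicClasses A'.X 1 :=
    lefschetzOneOne_rational_holds hA'sp _ ((hHfib s₁).1.map _) ((hHfib s₁).2.map_of_iso e₁)
  have hh₁n : complexBetti.map e₁.hom (2 * (m + 1)) (cupPowTwo (complexBetti.map (fiberι f s₁) 2 H) (m + 1)) ∈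
      algebraicClasses A'.X (m + 1) := by
    rw [complexBetti_map_cupPowTwo]
    exact cupPowTwo_mem_algebraicClasses_abelian A' hh₁alg m
  have hHn : cupPowTwo (complexBetti.map (fiberι f s₁) 2 H) (m + 1) ∈ algebraicClasses (fiberOver f s₁) (m + 1) :=
    owf_isoTransport _ A' e₁ (m + 1) _ hh₁n
  -- hence `W_{s₁} = w₁` is algebraic on `𝒳_{s₁}`
  have hW₁alg : w₁ ∈ algebraicClasses (fiberOver f s₁) (m + 1) := by
    rw [← hW₁]
    have h := Submodule.sub_mem _ halg (Submodule.smul_mem _ (((q : ℚ) : ℂ)) hHn)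
    rwa [add_sub_cancel_left] at h
  -- a NON-ZERO ALGEBRAIC class of the Weil plane of `A'`: one class suffices (unconditional)
  have hw₁alg : complexBetti.map e₁.hom (2 * (m + 1)) w₁ ∈ algebraicClasses A'.X (m + 1) :=
    Theorems.isoInvariance_proof e₁ (m + 1) _ hW₁alg
  have hA'alg : weilClassesOf A' φ' (m + 1) d ≤ algebraicClasses A'.X (m + 1) :=
    (weilClassesOf_le_algebraicClasses_iff_exists_ne_zero_of_dim_eq abelianVarietyCohomologyExteriorH1_holds
      hA'dim (Nat.succ_pos m) hd hφ'A).mpr ⟨_, hw₁W, hw₁alg, hw₁0⟩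
  -- isogeny transfer `A → A'` (landed)
  have hφℤ : φ ≫ φ = -((d : ℤ) • 𝟙 A) := by rw [hφ, natCast_zsmul]
  exact stub_isogenyTransfer d (m + 1) A A' φ φ' hA hA'dim hφℤ u v m' hm' huv hu hv hA'alg

/-! ## The floor F0a (split sixfolds, every `d`) BY NAME from the local anchors -/

/-- **Split sixfolds from local anchors**: `weilFamilyReach_hyperbolic` ∧ (`∀ d ≥ 1`, a locally algebraic
hyperbolic anchor in dimension 6) ⟹ `Markman2025_weilClasses_algebraic_hyperbolicSixfold` (the floor fact's
STATEMENT, by name). [cite: Markman2025SecantWeil, Thm. 1.5.1] [cite: Deligne1982HodgeCycles, proof of Thm. 4.8] -/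
theorem markman2025_hyperbolicSixfold_of_reach_of_localAnchor (hF : weilFamilyReach_hyperbolic)
    (hL : ∀ d : ℕ, 0 < d → HasLocallyAlgebraicWeilAnchor 3 d) :
    Markman2025_weilClasses_algebraic_hyperbolicSixfold := by
  intro d hd A φ hA _ hφ e a ha ha0 hhyp c _ _ hcW
  exact weilClasses_algebraic_hyperbolic_of_localAnchor 3 d (by norm_num) hd (hL d hd) hF A φ hA hφ e a ha ha0
    hhyp hcW

/-- **F0a re-derived inside the skeleton**: Deligne's hyperbolic family with reach (refereed inputs) ∧ Markman's
LOCAL statement at the secant anchor (`Markman2025_secantAnchor_locallyAlgebraic_sixfold`, one sentence of the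
unrefereed preprint per `d`) ⟹ Markman's Thm. 1.5.1 in the tree's rendering
`Markman2025_weilClasses_algebraic_hyperbolicSixfold`. The countable-union/Baire step, the reach and the isogeny
transfer of Markman's last paragraph are kernel-checked; the dependence of the floor on arXiv:2502.03415 is thereby
confined to Thm. 1.4.1 + Lemma 9.3.11 + §7.4.2 (arXiv v2 numbering; held corpus rendering "§7.5.2") at ONE point.
[claim: Markman2025SecantWeil, status: under-review]
[cite: Deligne1982HodgeCycles, proof of Thm. 4.8] [cite: CharlesSchnell2014Notes, Prop. 11.3.11 (proof)] -/
theorem markman2025_hyperbolicSixfold_of_reach_of_secantAnchor (hF : weilFamilyReach_hyperbolic)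
    (hM : Markman2025_secantAnchor_locallyAlgebraic_sixfold) :
    Markman2025_weilClasses_algebraic_hyperbolicSixfold :=
  markman2025_hyperbolicSixfold_of_reach_of_localAnchor hF hM

/-! ## One and all dimensions up: the split rungs R2₈, R2 from local anchors -/

/-- **R2₈ (`SplitEightfolds`) ⟸ reach ∧ a locally algebraic hyperbolic anchor in dimension 8 for every `d`.**
The open content of the split-eightfold rung is exactly such an anchor (none is known: Markman §1.2 "the secant
variety … is a proper subvariety"; the cell's census of genus-4 candidates). [cite: Markman2025SecantWeil, §1.2]
[cite: Deligne1982HodgeCycles, proof of Thm. 4.8] -/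
theorem splitEightfolds_of_reach_of_localAnchor (hF : weilFamilyReach_hyperbolic)
    (hL : ∀ d : ℕ, 0 < d → HasLocallyAlgebraicWeilAnchor 4 d) : SplitEightfolds := by
  intro d hd A φ hA _ hφ e a ha ha0 hhyp c _ _ hcW
  exact weilClasses_algebraic_hyperbolic_of_localAnchor 4 d (by norm_num) hd (hL d hd) hF A φ hA hφ e a ha ha0
    hhyp hcW

/-- **R2 (`SplitWeilAbelianVarieties`, all `n ≥ 4`) ⟸ reach ∧ a locally algebraic hyperbolic anchor in every
dimension `2n ≥ 8` for every `d`.** [cite: Markman2025SecantWeil, §1.2] [cite: Deligne1982HodgeCycles, proof of Thm. 4.8] -/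
theorem splitWeilAbelianVarieties_of_reach_of_localAnchor (hF : weilFamilyReach_hyperbolic)
    (hL : ∀ n : ℕ, 4 ≤ n → ∀ d : ℕ, 0 < d → HasLocallyAlgebraicWeilAnchor n d) :
    SplitWeilAbelianVarieties := by
  intro n hn d hd A φ hA _ hφ e a ha ha0 hhyp c _ _ hcW
  exact weilClasses_algebraic_hyperbolic_of_localAnchor n d (by omega) hd (hL n hn d hd) hF A φ hA hφ e a ha ha0
    hhyp hcW

/-! ## The object-level cut feeds the class-level one: Perry (twisted) ∧ a `κ`-anchor object ⟹ LOCAL ANCHOR -/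

/-- **A semiregular `κ`-anchor OBJECT gives a locally algebraic anchor (via Perry's twisted theorem).** Let
`(P, ψ, e, a)` be a hyperbolic `√-d`-Weil abelian `2n`-fold with a non-zero rational Weil class `w`, carrying on
every chart `F₀ ≅ P.X`, for every standard Chern character theory, a finite locally free FULLY SEMIREGULAR `E₀`
and a rational `(1,1)` class `B₀` with `(exp(B₀) ∪ ch(E₀))_k = q_k·h_Kᵏ` (`k ≠ n`) and `= q_n·h_Kⁿ + w` (`k = n`)
— the `κ`-class shape of Markman's secant⊠² sheaves (§1.1), for a LOCALLY FREE object. Then, granting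
`Perry2026_semiregularTwisted_remainsAlgebraic`, `HasLocallyAlgebraicWeilAnchor n d` holds, with `U = S(ℂ)`:
along any family of the predicate, `B₀` is algebraic on the abelian anchor fibre (Lefschetz `(1,1)`,
`bField_mem_algebraicClasses_of_abelianChart`) and the twisted engine `engine_of_perry_twisted` makes
`q_n·H_sⁿ + W_s` algebraic on EVERY fibre. [claim: Perry2026Semiregularity, status: under-review]
[cite: Markman2025SecantWeil, §1.1 (the class κ) and §1.5] -/
theorem hasLocallyAlgebraicWeilAnchor_of_perryTwisted_kappaAnchorObject (n d : ℕ)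
    (hP : Perry2026_semiregularTwisted_remainsAlgebraic) (hC : Nonempty StandardChernCharacterBetti)
    (hO : ∃ (P : AbelianVariety ℂ) (ψ : P ⟶ P) (e : ProjectiveEmbedding P.X)
      (a : complexBetti (projectiveSpace e.n ℂ) 2) (w : complexBetti P.X (2 * n)),
      P.dim = 2 * n ∧ ψ ≫ ψ = -(d • 𝟙 P) ∧ IsRationalClass a ∧ a ≠ 0 ∧
      IsHyperbolicWeilType P ψ n
        ((d : ℂ) • complexBetti.map e.ι 2 a + complexBetti.map ψ.hom.hom.hom 2 (complexBetti.map e.ι 2 a)) ∧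
      w ∈ weilClassesOf P ψ n d ∧ IsRationalClass w ∧ w ≠ 0 ∧
      ∀ (F₀ : SchemeOver ℂ) (e₀ : P.X ≅ F₀) (C : StandardChernCharacterBetti),
        ∃ (E₀ : F₀.left.Modules) (hE₀ : IsFiniteLocallyFree E₀) (B₀ : complexBetti F₀ 2) (q : ℕ → ℚ),
          IsISemiregular hE₀ Set.univ ∧ IsRationalClass B₀ ∧ IsOfHodgeType (2 * n) F₀ 2 1 1 B₀ ∧
          (∀ k : ℕ, k ≠ n →
            expTwistCh C.toChernCharacterBetti F₀ B₀ E₀ k = ((q k : ℚ) : ℂ) • complexBetti.map e₀.inv (2 * k)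
              (cupPowTwo ((d : ℂ) • complexBetti.map e.ι 2 a +
                complexBetti.map ψ.hom.hom.hom 2 (complexBetti.map e.ι 2 a)) k)) ∧
          expTwistCh C.toChernCharacterBetti F₀ B₀ E₀ n = complexBetti.map e₀.inv (2 * n)
            (((q n : ℚ) : ℂ) • cupPowTwo ((d : ℂ) • complexBetti.map e.ι 2 a +
                complexBetti.map ψ.hom.hom.hom 2 (complexBetti.map e.ι 2 a)) n + w)) :
    HasLocallyAlgebraicWeilAnchor n d := by
  obtain ⟨P, ψ, e, a, w, hP8, hψ, ha, ha0, hhyp, hwW, hwrat, hw0, hobj⟩ := hO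
  refine ⟨P, ψ, e, a, w, hP8, hψ, ha, ha0, hhyp, hwW, hwrat, hw0, ?_⟩
  intro 𝒳 S f hf _ hSqp hirr hsm _ H W hH hW s₀ e' hH₀ hW₀
  set h : complexBetti P.X 2 :=
    (d : ℂ) • complexBetti.map e.ι 2 a + complexBetti.map ψ.hom.hom.hom 2 (complexBetti.map e.ι 2 a) with hhdef
  -- the anchor conditions, read on the fibre `𝒳_{s₀}`
  have hH₀' : complexBetti.map (fiberι f s₀) 2 H = complexBetti.map e'.inv 2 h := by
    rw [← hH₀, e'.complexBetti_map_inv_map_hom]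
  have hW₀' : complexBetti.map (fiberι f s₀) (2 * n) W = complexBetti.map e'.inv (2 * n) w := by
    rw [← hW₀, e'.complexBetti_map_inv_map_hom]
  -- the κ-anchor object on the fibre `𝒳_{s₀} ≅ P`
  obtain ⟨C⟩ := hC
  obtain ⟨E₀, hE₀, B₀, q, hsr, hB₀rat, hB₀H, hEk, hEn⟩ := hobj (fiberOver f s₀) e' C
  have hB₀alg : B₀ ∈ algebraicClasses (fiberOver f s₀) 1 :=
    bField_mem_algebraicClasses_of_abelianChart f s₀ P hP8 e' B₀ hB₀rat hB₀H
  have hk : ∀ k : ℕ, k ≠ n → expTwistCh C.toChernCharacterBetti (fiberOver f s₀) B₀ E₀ k =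
      ((q k : ℚ) : ℂ) • cupPowTwo (complexBetti.map (fiberι f s₀) 2 H) k := by
    intro k hkn
    rw [hEk k hkn, complexBetti_map_cupPowTwo, hH₀']
  have hn' : expTwistCh C.toChernCharacterBetti (fiberOver f s₀) B₀ E₀ n =
      ((q n : ℚ) : ℂ) • cupPowTwo (complexBetti.map (fiberι f s₀) 2 H) n +
        complexBetti.map (fiberι f s₀) (2 * n) W := by
    rw [hEn, map_add, map_smul, complexBetti_map_cupPowTwo, hH₀', hW₀']
  -- Perry, twisted: algebraic on EVERY fibre
  refine ⟨Set.univ, q n, isOpen_univ, Set.mem_univ _, fun s _ => ?_⟩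
  exact engine_of_perry_twisted hP n f hf hirr hsm hSqp H hH W (fun s => (hW s).1) (fun s => (hW s).2) s₀
    C.toChernCharacterBetti E₀ hE₀ hsr B₀ hB₀rat hB₀alg q hk hn' s

/-! ## On-path sanity: under HC the predicate is the existence of a hyperbolic anchor -/

/-- **HC ⟹ locally algebraic anchors, given a hyperbolic anchor with a non-zero rational Weil class**: under
`HodgeConjecture` every restriction `W|_{𝒳_s}` (rational of type `(n,n)` on a smooth projective fibre) is
algebraic, so the local clause holds with `U = S(ℂ)`, `q = 0`
(`localClause_of_forall_mem_algebraicClasses`). The existence of the anchor itself is the hypothesis `hP`.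
[folklore] -/
theorem hasLocallyAlgebraicWeilAnchor_of_hodgeConjecture (hHC : _root_.HodgeConjecture) (n d : ℕ)
    (hP : ∃ (P : AbelianVariety ℂ) (ψ₀ : P ⟶ P) (e : ProjectiveEmbedding P.X)
      (a : complexBetti (projectiveSpace e.n ℂ) 2) (w : complexBetti P.X (2 * n)),
      P.dim = 2 * n ∧ ψ₀ ≫ ψ₀ = -(d • 𝟙 P) ∧ IsRationalClass a ∧ a ≠ 0 ∧
      IsHyperbolicWeilType P ψ₀ n
        ((d : ℂ) • complexBetti.map e.ι 2 a + complexBetti.map ψ₀.hom.hom.hom 2 (complexBetti.map e.ι 2 a)) ∧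
      w ∈ weilClassesOf P ψ₀ n d ∧ IsRationalClass w ∧ w ≠ 0) :
    HasLocallyAlgebraicWeilAnchor n d := by
  obtain ⟨P, ψ₀, e, a, w, hP, hψ, ha, ha0, hhyp, hwW, hwrat, hw0⟩ := hP
  refine ⟨P, ψ₀, e, a, w, hP, hψ, ha, ha0, hhyp, hwW, hwrat, hw0, ?_⟩
  intro 𝒳 S f hf _ _ _ _ _ H W _ hW s₀ _ _ _
  exact localClause_of_forall_mem_algebraicClasses f H W s₀
    (fun s => (hHC (hf.isSmoothProjective s)).2 n _ (hW s).1 (hW s).2)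

end Summit.HodgeConjecture.HodgeConjecture.WeilTypeLadder

end
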